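import Mathlib.Analysis.SpecificLimits.Normed
import Mathlib.Analysis.Normed.Group.Tannery
import Mathlib.Analysis.SpecialFunctions.Log.Summable
import Mathlib.Topology.Algebra.InfiniteSum.Real
import Literature.Analysis.TotalPositivity.PolyaFrequency
import Literature.Analysis.TotalPositivity.PolyaFrequencyClosure
import Literature.Analysis.TotalPositivity.PolyaFrequencyDeflation
import Literature.Analysis.TotalPositivity.PolyaFrequencyZeros
import Literature.Analysis.TotalPositivity.PolyaFrequencyRecognition
import HarnessLib

/-!
# Stripping all the poles of a Pólya frequency generating function (proved, granted Ando's
# recognition theorem)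

Trunk T-ANALYSIS (Literature/Analysis/TotalPositivity). Part 4a of the decomposition of the named
fact `Literature.Analysis.TotalPositivity.aswe_edrei`: the iteration behind Aissen–Schoenberg–Whitney's Thm. 2
[AissenEdreiSchoenbergWhitney1951, Thm. 2] ("its generating function … may be extended into the
whole finite plane, being a meromorphic function" with poles `1/β_ν`, `β_ν ≥ 0`, `Σ β_ν < ∞`), run
inside the class of Pólya frequency sequences thanks to the pole-stripping step
`IsPolyaFrequencySeq.mulLinear_neg_of_ando` (PolyaFrequencyRecognition.lean; the only place where
the named fact `ando1987_lowerTriangular_tn` enters).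

For a PF sequence `b` with `b₀ = 1` put `β'(b) = lim b_{n+1}/bₙ` if all `bₙ > 0` and `β'(b) = 0`
otherwise (then `b` is finitely supported), and `strip b = (bₙ - β'(b) b_{n-1})ₙ`, the coefficients
of `(1 - β'(b) z) Σ bₙ zⁿ`. Iterating, `b⁽⁰⁾ = b`, `b⁽ᵏ⁺¹⁾ = strip b⁽ᵏ⁾`, `βₖ = β'(b⁽ᵏ⁾)`:

* every `b⁽ᵏ⁾` is PF with `b⁽ᵏ⁾₀ = 1` and `0 ≤ b⁽ᵏ⁺¹⁾ₙ ≤ b⁽ᵏ⁾ₙ` (`stripSeq_*`);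
* `Σ_{i<k} βᵢ = b₁ - b⁽ᵏ⁾₁ ≤ b₁`, so `Σ βᵢ < ∞` and `βₖ → 0` (`summable_stripPoles`);
* `Σ b⁽ᵏ⁾ₙ zⁿ` converges absolutely for `‖z‖ βₖ < 1` (ratio test) (`summable_stripSeq`);
* the termwise limit `γ = lim b⁽ᵏ⁾` (`stripLimit`) is PF with `γ₀ = 1`, its power series
  `G(z) = Σ γₙ zⁿ` converges on all of `ℂ`, and, for every `k` and `‖z‖ βₖ < 1`,
  `G(z) = (Σ b⁽ᵏ⁾ₙ zⁿ) · ∏_{i ≥ k} (1 - βᵢ z)` (Tannery's theorem) (`tsum_stripLimit_eq`); in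
  particular `G(x) > 0` for real `x ≥ 0` (`tsum_stripLimit_pos`) and, near `0`,
  `G = (Σ bₙ zⁿ) ∏ᵢ (1 - βᵢ z)`.

So `Σ bₙ zⁿ = G(z)/∏(1 - βᵢ z)` is meromorphic on `ℂ` with an ENTIRE numerator whose Taylor
sequence is PF — without Hadamard's theory of polar singularities used in print. Part 4b
(`ASWMeromorphic.lean`) strips the zeros through the reciprocal `1/f(-z)` and assembles Thm. 2.

## References

* M. Aissen, A. Edrei, I. J. Schoenberg, A. Whitney, Proc. Nat. Acad. Sci. USA 37 (1951)
  303–307, Thm. 2. [AissenEdreiSchoenbergWhitney1951]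
* M. Aissen, I. J. Schoenberg, A. M. Whitney, J. Analyse Math. 2 (1952) 93–103.
  [AissenSchoenbergWhitney1952]
* T. Ando, Linear Algebra Appl. 90 (1987) 165–219, Cor. 2.2. [Ando1987]
-/

noncomputable section

open Filter Finset Metric Complex
open scoped Topology

namespace Literature.Analysis.TotalPositivity

/-! ### One stripping step -/

/-- The pole to be stripped: `β'(b) = lim b_{n+1}/bₙ` (`ratioLimit b`) if all `bₙ > 0`, and `0`
otherwise. [folklore] -/
def stripPole (b : ℕ → ℝ) : ℝ := by
  classical
  exact if ∀ n, 0 < b n then ratioLimit b else 0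

/-- One stripping step: the coefficients of `(1 - β'(b) z) Σ bₙ zⁿ`. [folklore] -/
def stripStep (b : ℕ → ℝ) : ℕ → ℝ :=
  mulLinear b (-(stripPole b))

/-- The iteration `b⁽⁰⁾ = b`, `b⁽ᵏ⁺¹⁾ = strip b⁽ᵏ⁾`. [folklore] -/
def stripSeq (b : ℕ → ℝ) : ℕ → ℕ → ℝ
  | 0 => b
  | k + 1 => stripStep (stripSeq b k)

/-- The stripped poles `βₖ = β'(b⁽ᵏ⁾)`. [folklore] -/
def stripPoles (b : ℕ → ℝ) (k : ℕ) : ℝ :=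
  stripPole (stripSeq b k)

/-- `stripSeq` at `0`. [folklore] -/
@[simp] theorem stripSeq_zero_eq (b : ℕ → ℝ) : stripSeq b 0 = b := rfl

/-- `stripSeq` at successors. [folklore] -/
theorem stripSeq_succ (b : ℕ → ℝ) (k : ℕ) : stripSeq b (k + 1) = stripStep (stripSeq b k) := rfl

/-- `β'(b)` in the positive case. [folklore] -/
theorem stripPole_of_pos {b : ℕ → ℝ} (h : ∀ n, 0 < b n) : stripPole b = ratioLimit b := by
  simp [stripPole, h]

/-- `β'(b)` in the non-positive case. [folklore] -/
theorem stripPole_of_not_pos {b : ℕ → ℝ} (h : ¬ ∀ n, 0 < b n) : stripPole b = 0 := by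
  simp [stripPole, h]

/-- `β'(b) ≥ 0` for a column-positive `b`. [folklore] -/
theorem stripPole_nonneg {b : ℕ → ℝ} (hb : IsColumnPF b) : 0 ≤ stripPole b := by
  by_cases h : ∀ n, 0 < b n
  · rw [stripPole_of_pos h]; exact hb.ratioLimit_nonneg h
  · rw [stripPole_of_not_pos h]

/-- The zeroth term is unchanged. [folklore] -/
@[simp] theorem stripStep_zero (b : ℕ → ℝ) : stripStep b 0 = b 0 := by
  simp [stripStep]

/-- The later terms: `bₙ₊₁ - β' bₙ`. [folklore] -/
theorem stripStep_succ (b : ℕ → ℝ) (n : ℕ) :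
    stripStep b (n + 1) = b (n + 1) - stripPole b * b n := by
  simp [stripStep]; ring

/-- **The stripping step preserves PF** (granted Ando's recognition theorem): in the positive
case this is `IsPolyaFrequencySeq.mulLinear_neg_of_ando`, otherwise nothing happens.
[Aissen–Edrei–Schoenberg–Whitney 1951, Thm. 2] [folklore] -/
theorem IsPolyaFrequencySeq.stripStep (hA : ando1987_lowerTriangular_tn) {b : ℕ → ℝ}
    (hb : IsPolyaFrequencySeq b) : IsPolyaFrequencySeq (Literature.Analysis.TotalPositivity.stripStep b) := by
  by_cases h : ∀ n, 0 < b n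
  · rw [Literature.Analysis.TotalPositivity.stripStep, stripPole_of_pos h]
    exact hb.mulLinear_neg_of_ando hA h
  · rw [Literature.Analysis.TotalPositivity.stripStep, stripPole_of_not_pos h, neg_zero]
    have : Literature.Analysis.TotalPositivity.mulLinear b 0 = b := funext fun n => by
      simp [Literature.Analysis.TotalPositivity.mulLinear]
    rw [this]
    exact hb

/-- The stripping step decreases the terms: `strip b ≤ b` termwise (for `b ≥ 0`). [folklore] -/
theorem stripStep_le {b : ℕ → ℝ} (hb : IsColumnPF b) (n : ℕ) : stripStep b n ≤ b n := by
  rcases n with _ | n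
  · simp
  · rw [stripStep_succ]
    have := mul_nonneg (stripPole_nonneg hb) (hb.nonneg n)
    linarith

/-! ### The iteration -/

/-- Every `b⁽ᵏ⁾` is PF. [folklore] -/
theorem isPolyaFrequencySeq_stripSeq (hA : ando1987_lowerTriangular_tn) {b : ℕ → ℝ}
    (hb : IsPolyaFrequencySeq b) (k : ℕ) : IsPolyaFrequencySeq (stripSeq b k) := by
  induction k with
  | zero => exact hb
  | succ k ih => exact ih.stripStep hA

/-- `b⁽ᵏ⁾₀ = b₀`. [folklore] -/
@[simp] theorem stripSeq_apply_zero (b : ℕ → ℝ) (k : ℕ) : stripSeq b k 0 = b 0 := by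
  induction k with
  | zero => rfl
  | succ k ih => rw [stripSeq_succ, stripStep_zero, ih]

/-- `βₖ ≥ 0`. [folklore] -/
theorem stripPoles_nonneg (hA : ando1987_lowerTriangular_tn) {b : ℕ → ℝ}
    (hb : IsPolyaFrequencySeq b) (k : ℕ) : 0 ≤ stripPoles b k :=
  stripPole_nonneg (isPolyaFrequencySeq_stripSeq hA hb k).isColumnPF

/-- `b⁽ᵏ⁾ₙ ≥ 0`. [folklore] -/
theorem stripSeq_nonneg (hA : ando1987_lowerTriangular_tn) {b : ℕ → ℝ}
    (hb : IsPolyaFrequencySeq b) (k n : ℕ) : 0 ≤ stripSeq b k n :=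
  (isPolyaFrequencySeq_stripSeq hA hb k).nonneg n

/-- `b⁽ᵏ⁺¹⁾ ≤ b⁽ᵏ⁾` termwise. [folklore] -/
theorem stripSeq_succ_le (hA : ando1987_lowerTriangular_tn) {b : ℕ → ℝ}
    (hb : IsPolyaFrequencySeq b) (k n : ℕ) : stripSeq b (k + 1) n ≤ stripSeq b k n := by
  rw [stripSeq_succ]
  exact stripStep_le (isPolyaFrequencySeq_stripSeq hA hb k).isColumnPF n

/-- `k ↦ b⁽ᵏ⁾ₙ` is non-increasing. [folklore] -/
theorem stripSeq_antitone (hA : ando1987_lowerTriangular_tn) {b : ℕ → ℝ}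
    (hb : IsPolyaFrequencySeq b) (n : ℕ) : Antitone fun k => stripSeq b k n :=
  antitone_nat_of_succ_le fun k => stripSeq_succ_le hA hb k n

/-- `b⁽ᵏ⁾ ≤ b` termwise. [folklore] -/
theorem stripSeq_le (hA : ando1987_lowerTriangular_tn) {b : ℕ → ℝ}
    (hb : IsPolyaFrequencySeq b) (k n : ℕ) : stripSeq b k n ≤ b n :=
  stripSeq_antitone hA hb n (Nat.zero_le k)

/-- **The pole budget**: `b⁽ᵏ⁾₁ = b₁ - Σ_{i<k} βᵢ` when `b₀ = 1`. [folklore] -/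
theorem stripSeq_apply_one {b : ℕ → ℝ} (h0 : b 0 = 1) (k : ℕ) :
    stripSeq b k 1 = b 1 - ∑ i ∈ Finset.range k, stripPoles b i := by
  induction k with
  | zero => simp
  | succ k ih =>
    rw [stripSeq_succ, stripStep_succ, stripSeq_apply_zero, h0, mul_one, ih,
      Finset.sum_range_succ, stripPoles]
    ring

/-- `Σ_{i<k} βᵢ ≤ b₁`. [folklore] -/
theorem sum_stripPoles_le (hA : ando1987_lowerTriangular_tn) {b : ℕ → ℝ}
    (hb : IsPolyaFrequencySeq b) (h0 : b 0 = 1) (k : ℕ) :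
    ∑ i ∈ Finset.range k, stripPoles b i ≤ b 1 := by
  have h1 := stripSeq_apply_one h0 k
  have h2 := stripSeq_nonneg hA hb k 1
  linarith

/-- **`Σ βₖ < ∞`** (`≤ b₁`). [Aissen–Edrei–Schoenberg–Whitney 1951, Thm. 2 ("`Σ β_ν` convergent")]
[folklore] -/
theorem summable_stripPoles (hA : ando1987_lowerTriangular_tn) {b : ℕ → ℝ}
    (hb : IsPolyaFrequencySeq b) (h0 : b 0 = 1) : Summable (stripPoles b) :=
  summable_of_sum_range_le (stripPoles_nonneg hA hb) (sum_stripPoles_le hA hb h0)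

/-- `βₖ → 0`. [folklore] -/
theorem tendsto_stripPoles (hA : ando1987_lowerTriangular_tn) {b : ℕ → ℝ}
    (hb : IsPolyaFrequencySeq b) (h0 : b 0 = 1) : Tendsto (stripPoles b) atTop (𝓝 0) :=
  (summable_stripPoles hA hb h0).tendsto_atTop_zero

/-! ### Radius of convergence of `Σ b⁽ᵏ⁾ₙ zⁿ` -/

/-- A column-positive sequence with `b₀ > 0` which is not everywhere positive is finitely
supported. [folklore] -/
theorem IsColumnPF.eventually_eq_zero {b : ℕ → ℝ} (hb : IsColumnPF b) (h0 : 0 < b 0)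
    (h : ¬ ∀ n, 0 < b n) : ∃ N, ∀ n, N ≤ n → b n = 0 := by
  by_contra hne
  push Not at hne
  exact h fun n => hb.pos h0 (fun N => by
    obtain ⟨n, hn, hbn⟩ := hne N
    exact ⟨n, hn, hbn⟩) n

/-- **Absolute convergence of `Σ bₙ zⁿ` for `‖z‖ β'(b) < 1`** for a PF sequence `b` with `b₀ > 0`:
the ratio test in the positive case (`b_{n+1}/bₙ → β'(b)`), finite support otherwise.
[folklore] -/
theorem summable_norm_mul_pow_of_stripPole {b : ℕ → ℝ} (hb : IsColumnPF b) (h0 : 0 < b 0)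
    {z : ℂ} (hz : ‖z‖ * stripPole b < 1) : Summable fun n => ‖(b n : ℂ) * z ^ n‖ := by
  by_cases h : ∀ n, 0 < b n
  · rw [stripPole_of_pos h] at hz
    by_cases hz0 : z = 0
    · subst hz0
      refine summable_of_ne_finset_zero (s := {0}) fun n hn => ?_
      rw [Finset.mem_singleton] at hn
      simp [hn]
    · refine summable_of_ratio_test_tendsto_lt_one hz ?_ ?_
      · exact Eventually.of_forall fun n => by
          rw [norm_ne_zero_iff]
          exact mul_ne_zero (by exact_mod_cast (h n).ne') (pow_ne_zero _ hz0)
      · have ht := (hb.tendsto_ratio h).mul_const ‖z‖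
        rw [mul_comm] at hz
        refine (ht.congr fun n => ?_).mono_right (by rw [mul_comm])
        rw [norm_norm, norm_norm, norm_mul, norm_mul, norm_pow, norm_pow, Complex.norm_real,
          Complex.norm_real, Real.norm_of_nonneg (h n).le, Real.norm_of_nonneg (h (n + 1)).le,
          pow_succ]
        have hbn : (b n : ℝ) ≠ 0 := (h n).ne'
        have hzn : ‖z‖ ^ n ≠ 0 := pow_ne_zero _ (norm_ne_zero_iff.2 hz0)
        field_simp
  · obtain ⟨N, hN⟩ := hb.eventually_eq_zero h0 h
    refine summable_of_ne_finset_zero (s := Finset.range N) fun n hn => ?_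
    rw [Finset.mem_range, not_lt] at hn
    simp [hN n hn]

/-- The same for `b⁽ᵏ⁾` and `βₖ`: `Σ b⁽ᵏ⁾ₙ zⁿ` converges absolutely for `‖z‖ βₖ < 1`. [folklore] -/
theorem summable_stripSeq (hA : ando1987_lowerTriangular_tn) {b : ℕ → ℝ}
    (hb : IsPolyaFrequencySeq b) (h0 : b 0 = 1) (k : ℕ) {z : ℂ} (hz : ‖z‖ * stripPoles b k < 1) :
    Summable fun n => ‖(stripSeq b k n : ℂ) * z ^ n‖ :=
  summable_norm_mul_pow_of_stripPole (isPolyaFrequencySeq_stripSeq hA hb k).isColumnPF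
    (by rw [stripSeq_apply_zero, h0]; exact one_pos) hz

/-! ### The limit sequence `γ = lim b⁽ᵏ⁾` and its generating function -/

/-- The termwise limit `γₙ = lim_k b⁽ᵏ⁾ₙ = inf_k b⁽ᵏ⁾ₙ`. [folklore] -/
def stripLimit (b : ℕ → ℝ) (n : ℕ) : ℝ :=
  ⨅ k, stripSeq b k n

/-- `b⁽ᵏ⁾ₙ → γₙ`. [folklore] -/
theorem tendsto_stripSeq (hA : ando1987_lowerTriangular_tn) {b : ℕ → ℝ}
    (hb : IsPolyaFrequencySeq b) (n : ℕ) :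
    Tendsto (fun k => stripSeq b k n) atTop (𝓝 (stripLimit b n)) :=
  tendsto_atTop_ciInf (stripSeq_antitone hA hb n) ⟨0, by
    rintro _ ⟨k, rfl⟩; exact stripSeq_nonneg hA hb k n⟩

/-- `γ` is PF. [folklore] -/
theorem isPolyaFrequencySeq_stripLimit (hA : ando1987_lowerTriangular_tn) {b : ℕ → ℝ}
    (hb : IsPolyaFrequencySeq b) : IsPolyaFrequencySeq (stripLimit b) :=
  IsPolyaFrequencySeq.of_tendsto (l := atTop) (isPolyaFrequencySeq_stripSeq hA hb)
    (tendsto_stripSeq hA hb)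

/-- `γ₀ = b₀`. [folklore] -/
theorem stripLimit_zero (hA : ando1987_lowerTriangular_tn) {b : ℕ → ℝ}
    (hb : IsPolyaFrequencySeq b) : stripLimit b 0 = b 0 :=
  tendsto_nhds_unique (tendsto_stripSeq hA hb 0) (by simp)

/-- `0 ≤ γₙ ≤ b⁽ᵏ⁾ₙ`. [folklore] -/
theorem stripLimit_le (hA : ando1987_lowerTriangular_tn) {b : ℕ → ℝ}
    (hb : IsPolyaFrequencySeq b) (k n : ℕ) : stripLimit b n ≤ stripSeq b k n :=
  ciInf_le ⟨0, by rintro _ ⟨j, rfl⟩; exact stripSeq_nonneg hA hb j n⟩ k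

/-- `γₙ ≥ 0`. [folklore] -/
theorem stripLimit_nonneg (hA : ando1987_lowerTriangular_tn) {b : ℕ → ℝ}
    (hb : IsPolyaFrequencySeq b) (n : ℕ) : 0 ≤ stripLimit b n :=
  (isPolyaFrequencySeq_stripLimit hA hb).nonneg n

/-- **`G(z) = Σ γₙ zⁿ` converges absolutely on all of `ℂ`**: `0 ≤ γₙ ≤ b⁽ᵏ⁾ₙ` and `βₖ → 0`.
[folklore] -/
theorem summable_stripLimit (hA : ando1987_lowerTriangular_tn) {b : ℕ → ℝ}
    (hb : IsPolyaFrequencySeq b) (h0 : b 0 = 1) (z : ℂ) :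
    Summable fun n => ‖(stripLimit b n : ℂ) * z ^ n‖ := by
  -- choose `k` with `‖z‖ βₖ < 1`
  obtain ⟨k, hk⟩ : ∃ k, ‖z‖ * stripPoles b k < 1 := by
    have ht : Tendsto (fun k => ‖z‖ * stripPoles b k) atTop (𝓝 (‖z‖ * 0)) :=
      (tendsto_stripPoles hA hb h0).const_mul ‖z‖
    rw [mul_zero] at ht
    exact (ht.eventually (gt_mem_nhds one_pos)).exists
  refine (summable_stripSeq hA hb h0 k hk).of_nonneg_of_le (fun n => norm_nonneg _) fun n => ?_
  rw [norm_mul, norm_mul, Complex.norm_real, Complex.norm_real,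
    Real.norm_of_nonneg (stripLimit_nonneg hA hb n), Real.norm_of_nonneg (stripSeq_nonneg hA hb k n)]
  exact mul_le_mul_of_nonneg_right (stripLimit_le hA hb k n) (norm_nonneg _)

/-- Generating functions of the iterates: for `‖z‖ βₖ < 1` and `j ≥ k`,
`Σ b⁽ʲ⁾ₙ zⁿ = (Σ b⁽ᵏ⁾ₙ zⁿ) ∏_{k ≤ i < j} (1 - βᵢ z)`. [folklore] -/
theorem hasSum_stripSeq_add (hA : ando1987_lowerTriangular_tn) {b : ℕ → ℝ}
    (hb : IsPolyaFrequencySeq b) (h0 : b 0 = 1) (k : ℕ) {z : ℂ} (hz : ‖z‖ * stripPoles b k < 1)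
    (m : ℕ) :
    HasSum (fun n => (stripSeq b (k + m) n : ℂ) * z ^ n)
      ((∑' n, (stripSeq b k n : ℂ) * z ^ n) *
        ∏ i ∈ Finset.range m, (1 - (stripPoles b (k + i) : ℂ) * z)) := by
  induction m with
  | zero => simpa using (summable_stripSeq hA hb h0 k hz).of_norm.hasSum
  | succ m ih =>
    have h := hasSum_mulLinear ih (-(stripPoles b (k + m)))
    rw [show k + (m + 1) = k + m + 1 by ring, stripSeq_succ]
    convert h using 1
    · rfl
    · rw [Finset.prod_range_succ]
      push_cast
      ring

/-- **Tannery step**: `G(z) = (Σ b⁽ᵏ⁾ₙ zⁿ) · ∏_{i ≥ k} (1 - βᵢ z)` for `‖z‖ βₖ < 1` (the iterates'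
series converge to `G(z)` by dominated convergence, `0 ≤ b⁽ʲ⁾ₙ ≤ b⁽ᵏ⁾ₙ`, while their closed
forms converge to the infinite product). [folklore] -/
theorem tsum_stripLimit_eq (hA : ando1987_lowerTriangular_tn) {b : ℕ → ℝ}
    (hb : IsPolyaFrequencySeq b) (h0 : b 0 = 1) (k : ℕ) {z : ℂ} (hz : ‖z‖ * stripPoles b k < 1) :
    ∑' n, (stripLimit b n : ℂ) * z ^ n =
      (∑' n, (stripSeq b k n : ℂ) * z ^ n) * ∏' i, (1 - (stripPoles b (k + i) : ℂ) * z) := by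
  -- the left-hand side as a limit of the iterates' sums (Tannery)
  have hlim1 : Tendsto (fun m => ∑' n, (stripSeq b (k + m) n : ℂ) * z ^ n) atTop
      (𝓝 (∑' n, (stripLimit b n : ℂ) * z ^ n)) := by
    refine tendsto_tsum_of_dominated_convergence (bound := fun n => ‖(stripSeq b k n : ℂ) * z ^ n‖)
      (summable_stripSeq hA hb h0 k hz) (fun n => ?_) (Eventually.of_forall fun m n => ?_)
    · have ht := ((Complex.continuous_ofReal.tendsto _).comp
        ((tendsto_stripSeq hA hb n).comp (tendsto_add_atTop_nat k))).mul_const (z ^ n)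
      refine ht.congr fun m => ?_
      simp [Function.comp_apply, add_comm k m]
    · rw [norm_mul, norm_mul, Complex.norm_real, Complex.norm_real,
        Real.norm_of_nonneg (stripSeq_nonneg hA hb _ n),
        Real.norm_of_nonneg (stripSeq_nonneg hA hb k n)]
      refine mul_le_mul_of_nonneg_right ?_ (norm_nonneg _)
      exact stripSeq_antitone hA hb n (Nat.le_add_right k m)
  -- the same sums in closed form converge to the product
  have hmult : Multipliable fun i => 1 - (stripPoles b (k + i) : ℂ) * z := by
    have hs : Summable fun i => ‖-((stripPoles b (k + i) : ℂ) * z)‖ := by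
      have h1 := (((summable_stripPoles hA hb h0).comp_injective
        (add_right_injective k)).mul_right ‖z‖).norm
      refine h1.congr fun i => ?_
      simp [Function.comp_apply, norm_mul, abs_of_nonneg (stripPoles_nonneg hA hb (k + i))]
    have := multipliable_one_add_of_summable hs
    simpa [sub_eq_add_neg] using this
  have hprod := hmult.hasProd
  have hlim2 : Tendsto (fun m => ∑' n, (stripSeq b (k + m) n : ℂ) * z ^ n) atTop
      (𝓝 ((∑' n, (stripSeq b k n : ℂ) * z ^ n) * ∏' i, (1 - (stripPoles b (k + i) : ℂ) * z))) := by
    have h2 := (hprod.tendsto_prod_nat).const_mul (∑' n, (stripSeq b k n : ℂ) * z ^ n)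
    refine h2.congr fun m => ?_
    exact ((hasSum_stripSeq_add hA hb h0 k hz m).tsum_eq).symm
  exact tendsto_nhds_unique hlim1 hlim2

/-- The case `k = 0`: near `0`, `G(z) = (Σ bₙ zⁿ) ∏ᵢ (1 - βᵢ z)`. [folklore] -/
theorem tsum_stripLimit_eq_zero (hA : ando1987_lowerTriangular_tn) {b : ℕ → ℝ}
    (hb : IsPolyaFrequencySeq b) (h0 : b 0 = 1) {z : ℂ} (hz : ‖z‖ * stripPoles b 0 < 1) :
    ∑' n, (stripLimit b n : ℂ) * z ^ n =
      (∑' n, (b n : ℂ) * z ^ n) * ∏' i, (1 - (stripPoles b i : ℂ) * z) := by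
  simpa using tsum_stripLimit_eq hA hb h0 0 hz

/-- **Positivity of `G` on `[0, ∞)`**: `G(x) = (Σ b⁽ᵏ⁾ₙ xⁿ) ∏_{i≥k} (1 - βᵢ x) ≥ 1 · ∏ > 0` for
`k` so large that `βᵢ x < 1` (`i ≥ k`). [folklore] -/
theorem tsum_stripLimit_pos (hA : ando1987_lowerTriangular_tn) {b : ℕ → ℝ}
    (hb : IsPolyaFrequencySeq b) (h0 : b 0 = 1) {x : ℝ} (hx : 0 ≤ x) :
    0 < ∑' n, stripLimit b n * x ^ n := by
  -- choose `k` with `x βᵢ ≤ 1/2` for all `i ≥ k`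
  obtain ⟨k, hk⟩ : ∃ k, ∀ i, k ≤ i → x * stripPoles b i < 1 / 2 := by
    have ht : Tendsto (fun i => x * stripPoles b i) atTop (𝓝 (x * 0)) :=
      (tendsto_stripPoles hA hb h0).const_mul x
    rw [mul_zero] at ht
    exact eventually_atTop.1 (ht.eventually (gt_mem_nhds (by norm_num)))
  have hk0 : ‖(x : ℂ)‖ * stripPoles b k < 1 := by
    rw [Complex.norm_real, Real.norm_of_nonneg hx]; linarith [hk k le_rfl]
  -- the identity at the real point `x`
  have hG := tsum_stripLimit_eq hA hb h0 k hk0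
  -- real forms of the three quantities
  have hsumL : Summable fun n => stripLimit b n * x ^ n := by
    have := (summable_stripLimit hA hb h0 (x : ℂ)).of_norm
    rw [← Complex.summable_ofReal]
    refine this.congr fun n => ?_
    push_cast; ring
  have hsumK : Summable fun n => stripSeq b k n * x ^ n := by
    have := (summable_stripSeq hA hb h0 k hk0).of_norm
    rw [← Complex.summable_ofReal]
    refine this.congr fun n => ?_
    push_cast; ring
  have e1 : (∑' n, (stripLimit b n : ℂ) * (x : ℂ) ^ n) = ((∑' n, stripLimit b n * x ^ n : ℝ) : ℂ) := by
    rw [Complex.ofReal_tsum]; push_cast; rfl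
  have e2 : (∑' n, (stripSeq b k n : ℂ) * (x : ℂ) ^ n) = ((∑' n, stripSeq b k n * x ^ n : ℝ) : ℂ) := by
    rw [Complex.ofReal_tsum]; push_cast; rfl
  -- the real product is positive
  have hβs : Summable fun i => stripPoles b (k + i) * x :=
    ((summable_stripPoles hA hb h0).comp_injective (add_right_injective k)).mul_right x
  have hfac : ∀ i, 0 < 1 - stripPoles b (k + i) * x := fun i => by
    have := hk (k + i) (Nat.le_add_right k i)
    nlinarith [stripPoles_nonneg hA hb (k + i)]
  have hmult : Multipliable fun i => 1 - stripPoles b (k + i) * x := by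
    have : Multipliable fun i => (1 : ℝ) + -(stripPoles b (k + i) * x) :=
      multipliable_one_add_of_summable (by simpa using hβs.norm)
    simpa [sub_eq_add_neg] using this
  have e3 : (∏' i, (1 - (stripPoles b (k + i) : ℂ) * (x : ℂ))) =
      ((∏' i, (1 - stripPoles b (k + i) * x) : ℝ) : ℂ) := by
    have := (hmult.hasProd.map Complex.ofRealHom Complex.continuous_ofReal).tprod_eq
    rw [Complex.ofRealHom_eq_coe] at this
    rw [← this]
    exact tprod_congr fun i => by simp [Function.comp_apply]
  have hprodpos : 0 < ∏' i, (1 - stripPoles b (k + i) * x) := by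
    have hne : ∏' i, (1 - (stripPoles b (k + i) : ℂ) * (x : ℂ)) ≠ 0 := by
      refine tprod_one_sub_ne_zero ?_ fun i => ?_
      · have h1 := ((summable_stripPoles hA hb h0).comp_injective (add_right_injective k)).norm
        refine h1.congr fun i => ?_
        simp [Function.comp_apply, abs_of_nonneg (stripPoles_nonneg hA hb (k + i))]
      · rw [Complex.norm_real, Complex.norm_real, Real.norm_of_nonneg (stripPoles_nonneg hA hb _),
          Real.norm_of_nonneg hx, mul_comm]
        linarith [hk (k + i) (Nat.le_add_right k i)]
    rw [e3, Complex.ofReal_ne_zero] at hne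
    have hge : 0 ≤ ∏' i, (1 - stripPoles b (k + i) * x) :=
      ge_of_tendsto' hmult.hasProd fun s => Finset.prod_nonneg fun i _ => (hfac i).le
    exact lt_of_le_of_ne hge (Ne.symm hne)
  rw [e1, e2, e3] at hG
  have hG' : (∑' n, stripLimit b n * x ^ n) =
      (∑' n, stripSeq b k n * x ^ n) * ∏' i, (1 - stripPoles b (k + i) * x) := by
    exact_mod_cast hG
  rw [hG']
  refine mul_pos ?_ hprodpos
  -- `Σ b⁽ᵏ⁾ₙ xⁿ ≥ b⁽ᵏ⁾₀ = 1`
  have h1 : stripSeq b k 0 * x ^ 0 ≤ ∑' n, stripSeq b k n * x ^ n :=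
    hsumK.le_tsum 0 fun j _ => mul_nonneg (stripSeq_nonneg hA hb k j) (pow_nonneg hx j)
  rw [stripSeq_apply_zero, h0, pow_zero, one_mul] at h1
  linarith

end Literature.Analysis.TotalPositivity
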